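import Literature.MathematicalPhysics.QuantumFieldTheory.Z2WilsonLoopGKS
import Literature.MathematicalPhysics.QuantumFieldTheory.LatticeGaugeAsymptoticsCornerEdges
import Literature.Probability.LatticeModels.GKSFrozenProduct
import HarnessLib

/-!
# GKS upper bound for `ℤ₂` Wilson loops on the torus: `⟨W_γ⟩ ≤ (tanh 2(d-1)β)^{ℓ - ℓ₀}`

Sequel of `Z2WilsonLoopGKS.lean` (the torus `ℤ₂` Wilson theory as the ferromagnetic plaquette
system `ν ∝ exp (∑ₚ β ω_{Cₚ})`). With the freezing bound
`Literature.Probability.LatticeModels.gksExpect_spinProduct_le_tanh_pow` (GKS II: freeze every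
spin off a set `A₁` of loop edges no two of which lie on a common plaquette; the frozen system
is a product of independent spins with weights `e^{k_a ω_a}`) we prove, for every `β ≥ 0`, every
torus `Λ_M = (ℤ/Mℤ)^d` and every self-avoiding lattice loop `γ` (a trail in `zdGraph d`) of
length `ℓ` with `ℓ + 2 < M`:

`0 ≤ ⟨W_γ⟩_{Λ_M,β} ≤ (tanh (2(d-1)β))^{ℓ - ℓ₀}`,

`ℓ₀ = numCornerEdges γ` the number of corner edges in Chatterjee's sense (edges of `γ` sharing a
plaquette of `ℤ^d` with another edge of `γ`). For `d = 4` this is `(tanh 6β)^{ℓ-ℓ₀}`, the bound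
`|⟨W_γ⟩_β| ≤ ∏_{e ∈ γ₁} |μ'_β(σ_e)| ≤ (1 - 2/(1 + e^{12β}))^{ℓ-ℓ₀}` of S. Chatterjee, *Wilson loops
in Ising lattice gauge theory*, Comm. Math. Phys. 377 (2020), Lemma 7.2 (there: for the
free-boundary infinite-volume state, by conditioning on the spins off `γ₁`), here in finite volume
with periodic boundary conditions and hence (`WilsonLoopsProofs` pattern) for every infinite-volume
limit point of the torus states: `loopExpectation_z2_nonneg`, `loopExpectation_z2_le_tanh_pow`.
Everything is proved; no named fact is introduced.

## Contents

* `card_filter_mem_torusPlaqEdges_le`: a torus edge lies on at most `2(d-1)` plaquettes, so its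
  total coupling is `k_a ≤ 2(d-1)β` (`siteCoupling_torus_le`).
* `eq_or_sharePlaquette_of_torus`: on a torus of side `M > ℓ + 2` two edges of `γ` whose
  periodisations lie on a common torus plaquette coincide or share a plaquette of `ℤ^d` (lift the
  torus plaquette next to the first edge, `exists_projPlaq_eq_of_mem`; the periodisation is
  injective at that scale); hence the periodised non-corner edges `torusNonCornerEdges` meet
  every interaction set `Cₚ` at most once (`card_torusPlaqEdges_inter_nonCorner_le_one`), and
  there are `ℓ - ℓ₀` of them (`card_torusNonCornerEdges`).
* `wilsonExpectation_z2_le_tanh_pow` (finite volume), `loopExpectation_z2_nonneg`,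
  `loopExpectation_z2_le_tanh_pow`, `loopExpectation_z2_mem_Icc_d4` (limit points) and
  `loopExpectation_z2_le_chatterjee_d4` (the printed form `(1 - 2/(1 + e^{12β}))^{ℓ-ℓ₀}`).

## References

* S. Chatterjee, Comm. Math. Phys. 377 (2020) 307–340, arXiv:1811.09770, Lemma 7.2 and §7.
  [arXiv181109770]
* S. Friedli, Y. Velenik, *Statistical Mechanics of Lattice Systems* (2017), §3.8.1, Ex. 3.12.
  [FriedliVelenik2017]
-/

noncomputable section

open MeasureTheory Filter Topology SimpleGraph Finset
open Literature.Probability.LatticeModels Literature.MathematicalPhysics.QuantumLattice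

namespace Literature.MathematicalPhysics.QuantumFieldTheory

variable {d : ℕ}

/-! ### `tanh` is monotone and nonnegative on `[0, ∞)` -/

/-- `tanh x = 1 - 2 / (e^{2x} + 1)`. [folklore] -/
theorem tanh_eq_one_sub_div (x : ℝ) : Real.tanh x = 1 - 2 / (Real.exp (2 * x) + 1) := by
  rw [Real.tanh_eq]
  have h1 : Real.exp (2 * x) = Real.exp x * Real.exp x := by rw [two_mul, Real.exp_add]
  have hx : 0 < Real.exp x := Real.exp_pos x
  have hnx : Real.exp (-x) = (Real.exp x)⁻¹ := Real.exp_neg x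
  rw [hnx, h1]
  field_simp
  ring

/-- `tanh` is monotone. [folklore] -/
theorem tanh_le_tanh {x y : ℝ} (h : x ≤ y) : Real.tanh x ≤ Real.tanh y := by
  rw [tanh_eq_one_sub_div, tanh_eq_one_sub_div]
  have hx : 0 < Real.exp (2 * x) + 1 := by positivity
  have hxy : Real.exp (2 * x) + 1 ≤ Real.exp (2 * y) + 1 := by
    have := Real.exp_le_exp.2 (by linarith : 2 * x ≤ 2 * y)
    linarith
  have : 2 / (Real.exp (2 * y) + 1) ≤ 2 / (Real.exp (2 * x) + 1) :=
    div_le_div_of_nonneg_left (by norm_num) hx hxy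
  linarith

/-- `0 ≤ tanh x` for `0 ≤ x`. [folklore] -/
theorem tanh_nonneg {x : ℝ} (hx : 0 ≤ x) : 0 ≤ Real.tanh x := by
  have := tanh_le_tanh hx
  rwa [Real.tanh_zero] at this

/-! ### An edge of the torus lies on at most `2(d-1)` plaquettes -/

section Count

variable {M : ℕ} [NeZero M]

omit [NeZero M] in
/-- `#(A ∪ B ∪ C ∪ D) ≤ #A + #B + #C + #D`. [folklore] -/
theorem card_union₄_le {α : Type*} [DecidableEq α] (A B C D : Finset α) :
    (A ∪ B ∪ C ∪ D).card ≤ A.card + B.card + C.card + D.card := by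
  have h1 := Finset.card_union_le (A ∪ B ∪ C) D
  have h2 := Finset.card_union_le (A ∪ B) C
  have h3 := Finset.card_union_le A B
  omega

omit [NeZero M] in
/-- The plaquettes of the torus containing the edge `(x, k)` are among the `(x; k, j)`,
`(x - eⱼ; k, j)` (`k < j`) and `(x; i, k)`, `(x - eᵢ; i, k)` (`i < k`). [folklore] -/
theorem mem_torusPlaqEdges_cases {a : Edge d M} {p : Plaquette d M} (h : a ∈ torusPlaqEdges p) :
    (p.2.1.1 = a.2 ∧ (p.1 = a.1 ∨ p.1.shift p.2.1.2 = a.1)) ∨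
      (p.2.1.2 = a.2 ∧ (p.1 = a.1 ∨ p.1.shift p.2.1.1 = a.1)) := by
  simp only [torusPlaqEdges, Finset.mem_insert, Finset.mem_singleton] at h
  rcases h with rfl | rfl | rfl | rfl
  · exact Or.inl ⟨rfl, Or.inl rfl⟩
  · exact Or.inr ⟨rfl, Or.inr rfl⟩
  · exact Or.inl ⟨rfl, Or.inr rfl⟩
  · exact Or.inr ⟨rfl, Or.inl rfl⟩

/-- The candidate plaquettes through the edge `a = (x, k)`: base point `x` or `x - e_m` (`m` the
other direction), direction pair containing `k`. [folklore] -/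
def plaqCandidates (a : Edge d M) : Finset (Plaquette d M) :=
  ((univ.filter fun q : {q : Fin d × Fin d // q.1 < q.2} => q.1.1 = a.2).image fun q => (a.1, q)) ∪
  ((univ.filter fun q : {q : Fin d × Fin d // q.1 < q.2} => q.1.1 = a.2).image
      fun q => (a.1 - Pi.single q.1.2 1, q)) ∪
  ((univ.filter fun q : {q : Fin d × Fin d // q.1 < q.2} => q.1.2 = a.2).image fun q => (a.1, q)) ∪
  ((univ.filter fun q : {q : Fin d × Fin d // q.1 < q.2} => q.1.2 = a.2).image
      fun q => (a.1 - Pi.single q.1.1 1, q))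

omit [NeZero M] in
/-- Every plaquette through `a` is a candidate. [folklore] -/
theorem mem_plaqCandidates_of_mem {a : Edge d M} {p : Plaquette d M} (h : a ∈ torusPlaqEdges p) :
    p ∈ plaqCandidates a := by
  obtain ⟨x, q⟩ := p
  simp only [plaqCandidates, Finset.mem_union, Finset.mem_image, Finset.mem_filter, Finset.mem_univ,
    true_and]
  rcases mem_torusPlaqEdges_cases h with ⟨hk, hx | hx⟩ | ⟨hk, hx | hx⟩
  · exact Or.inl (Or.inl (Or.inl ⟨q, hk, by rw [← hx]⟩))
  · refine Or.inl (Or.inl (Or.inr ⟨q, hk, ?_⟩))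
    rw [← hx]; simp [Site.shift]
  · exact Or.inl (Or.inr ⟨q, hk, by rw [← hx]⟩)
  · refine Or.inr ⟨q, hk, ?_⟩
    rw [← hx]; simp [Site.shift]

/-- The number of direction pairs `(k, j)`, `k < j`, is at most `d - 1 - k`… together with the pairs
`(i, k)`, `i < k`, there are exactly `d - 1` pairs containing `k`. We only need the bound
`#{q | q.1 = k} + #{q | q.2 = k} ≤ d - 1`. [folklore] -/
theorem card_pairs_containing_le (k : Fin d) :
    (univ.filter fun q : {q : Fin d × Fin d // q.1 < q.2} => q.1.1 = k).card +
      (univ.filter fun q : {q : Fin d × Fin d // q.1 < q.2} => q.1.2 = k).card ≤ d - 1 := by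
  -- inject both into `Fin d \\ {k}` via "the other index"
  have h1 : (univ.filter fun q : {q : Fin d × Fin d // q.1 < q.2} => q.1.1 = k).card =
      ((univ.filter fun q : {q : Fin d × Fin d // q.1 < q.2} => q.1.1 = k).image
        fun q => q.1.2).card := by
    refine (Finset.card_image_of_injOn fun q hq q' hq' hqq' => ?_).symm
    simp only [Finset.coe_filter, Finset.mem_univ, true_and, Set.mem_setOf_eq] at hq hq'
    exact Subtype.ext (Prod.ext (hq.trans hq'.symm) hqq')
  have h2 : (univ.filter fun q : {q : Fin d × Fin d // q.1 < q.2} => q.1.2 = k).card =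
      ((univ.filter fun q : {q : Fin d × Fin d // q.1 < q.2} => q.1.2 = k).image
        fun q => q.1.1).card := by
    refine (Finset.card_image_of_injOn fun q hq q' hq' hqq' => ?_).symm
    simp only [Finset.coe_filter, Finset.mem_univ, true_and, Set.mem_setOf_eq] at hq hq'
    exact Subtype.ext (Prod.ext hqq' (hq.trans hq'.symm))
  rw [h1, h2, ← Finset.card_union_of_disjoint]
  · have hsub : ((univ.filter fun q : {q : Fin d × Fin d // q.1 < q.2} => q.1.1 = k).image
          fun q => q.1.2) ∪
        ((univ.filter fun q : {q : Fin d × Fin d // q.1 < q.2} => q.1.2 = k).image fun q => q.1.1) ⊆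
        univ.erase k := by
      intro m hm
      simp only [Finset.mem_union, Finset.mem_image, Finset.mem_filter, Finset.mem_univ, true_and,
        Finset.mem_erase, and_true] at hm ⊢
      rcases hm with ⟨q, hq, rfl⟩ | ⟨q, hq, rfl⟩
      · exact (hq ▸ q.2).ne'
      · exact (hq ▸ q.2).ne
    refine (Finset.card_le_card hsub).trans ?_
    rw [Finset.card_erase_of_mem (Finset.mem_univ k), Finset.card_univ, Fintype.card_fin]
  · rw [Finset.disjoint_left]
    intro m hm hm'
    simp only [Finset.mem_image, Finset.mem_filter, Finset.mem_univ, true_and] at hm hm'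
    obtain ⟨q, hq, rfl⟩ := hm
    obtain ⟨q', hq', hqq'⟩ := hm'
    have h1 : k < q.1.2 := hq ▸ q.2
    have h2 : q'.1.1 < k := hq' ▸ q'.2
    rw [hqq'] at h2
    exact lt_asymm h1 h2

/-- **An edge of the torus lies on at most `2(d-1)` plaquettes** (exactly `2(d-1)` for `M ≥ 2`;
only the bound is needed). [folklore] -/
theorem card_filter_mem_torusPlaqEdges_le (a : Edge d M) :
    (univ.filter fun p : Plaquette d M => a ∈ torusPlaqEdges p).card ≤ 2 * (d - 1) := by
  calc (univ.filter fun p : Plaquette d M => a ∈ torusPlaqEdges p).card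
      ≤ (plaqCandidates a).card :=
        Finset.card_le_card fun p hp => mem_plaqCandidates_of_mem (Finset.mem_filter.1 hp).2
    _ ≤ (univ.filter fun q : {q : Fin d × Fin d // q.1 < q.2} => q.1.1 = a.2).card +
          (univ.filter fun q : {q : Fin d × Fin d // q.1 < q.2} => q.1.1 = a.2).card +
          (univ.filter fun q : {q : Fin d × Fin d // q.1 < q.2} => q.1.2 = a.2).card +
          (univ.filter fun q : {q : Fin d × Fin d // q.1 < q.2} => q.1.2 = a.2).card := by
        unfold plaqCandidates
        refine (card_union₄_le _ _ _ _).trans ?_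
        exact Nat.add_le_add (Nat.add_le_add (Nat.add_le_add Finset.card_image_le
          Finset.card_image_le) Finset.card_image_le) Finset.card_image_le
    _ ≤ 2 * (d - 1) := by
        have := card_pairs_containing_le (d := d) a.2
        omega

/-- The total coupling through a torus edge is `β` times the number of plaquettes containing it,
hence at most `2(d-1)β` (`= 6β` in `ℤ⁴`; Chatterjee 2020, proof of Lemma 7.2: `|m| ≤ 6`).
[cite: arXiv181109770, proof of Lemma 7.2] -/
theorem siteCoupling_torus_le {β : ℝ} (hβ : 0 ≤ β) (a : Edge d M) :
    siteCoupling (univ : Finset (Plaquette d M)) (fun _ => β) torusPlaqEdges a ≤ 2 * (d - 1 : ℕ) * β := by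
  rw [siteCoupling_def, Finset.sum_const, nsmul_eq_mul]
  calc ((univ.filter fun p : Plaquette d M => a ∈ torusPlaqEdges p).card : ℝ) * β
      ≤ (2 * (d - 1) : ℕ) * β := by
        refine mul_le_mul_of_nonneg_right ?_ hβ
        exact_mod_cast card_filter_mem_torusPlaqEdges_le a
    _ = 2 * (d - 1 : ℕ) * β := by push_cast; ring

/-- The total coupling through a torus edge is nonnegative for `β ≥ 0`. [folklore] -/
theorem siteCoupling_torus_nonneg {β : ℝ} (hβ : 0 ≤ β) (a : Edge d M) :
    0 ≤ siteCoupling (univ : Finset (Plaquette d M)) (fun _ => β) torusPlaqEdges a := by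
  rw [siteCoupling_def]
  exact Finset.sum_nonneg fun _ _ => hβ

end Count

/-! ### Non-corner edges stay separated on a large torus -/

section Separation

variable {M : ℕ}

/-- Two lattice sites with the same periodisation and all coordinate differences `< M` are equal.
[folklore] -/
theorem eq_of_proj_eq_of_abs_sub_lt {y y' : Literature.Probability.LatticeModels.Site d}
    (h : Torus.proj M y = Torus.proj M y') (hlt : ∀ k, |y k - y' k| < M) : y = y' := by
  funext k
  have hk : ((y k : ℤ) : ZMod M) = ((y' k : ℤ) : ZMod M) := by
    have := congrFun h k
    simpa [Torus.proj] using this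
  rw [ZMod.intCast_eq_intCast_iff_dvd_sub] at hk
  have habs : |y' k - y k| < M := by rw [abs_sub_comm]; exact hlt k
  have h0 := Int.eq_zero_of_abs_lt_dvd hk habs
  linarith

/-- The torus plaquette below a plaquette of `ℤ^d`. [folklore] -/
def projPlaq (M : ℕ) (P : ZdPlaquette d) : Plaquette d M :=
  (Torus.proj M P.1, P.2)

/-- Periodisation commutes with the unit shifts: `proj (x + eᵢ) = (proj x).shift i`. [folklore] -/
theorem proj_add_single_eq_shift (M : ℕ) (x : Literature.Probability.LatticeModels.Site d) (i : Fin d) :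
    Torus.proj M (x + Pi.single i 1) = Site.shift (Torus.proj M x) i := by
  rw [torusProj_add_single, Int.cast_one]; rfl

/-- The periodisation maps the edges of a plaquette of `ℤ^d` onto the edges of the torus
plaquette below it. [folklore] -/
theorem torusPlaqEdges_projPlaq (M : ℕ) (P : ZdPlaquette d) :
    torusPlaqEdges (projPlaq M P) = (plaquetteEdges P).image (torusEdge M) := by
  simp only [torusPlaqEdges, projPlaq, plaquetteEdges, Finset.image_insert, Finset.image_singleton,
    torusEdge, proj_add_single_eq_shift]

/-- The edges of a plaquette are within distance `1` of its base point. [folklore] -/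
theorem abs_sub_le_one_of_mem_plaquetteEdges {P : ZdPlaquette d} {e : ZdEdge d}
    (he : e ∈ plaquetteEdges P) (k : Fin d) : |e.1 k - P.1 k| ≤ 1 := by
  simp only [plaquetteEdges, Finset.mem_insert, Finset.mem_singleton] at he
  rcases he with rfl | rfl | rfl | rfl
  · simp
  · by_cases hk : k = P.2.1.1
    · subst hk; simp
    · simp [Pi.single_eq_of_ne hk]
  · by_cases hk : k = P.2.1.2
    · subst hk; simp
    · simp [Pi.single_eq_of_ne hk]
  · simp

/-- **Lifting a torus plaquette next to an edge of `ℤ^d`**: if the periodisation of `e` lies on the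
torus plaquette `p`, then `p` is the periodisation of a plaquette `P` of `ℤ^d` containing `e`,
with base point within distance `1` of that of `e`. [folklore] -/
theorem exists_projPlaq_eq_of_mem {e : ZdEdge d} {p : Plaquette d M}
    (h : torusEdge M e ∈ torusPlaqEdges p) :
    ∃ P : ZdPlaquette d, projPlaq M P = p ∧ e ∈ plaquetteEdges P ∧ ∀ k, |P.1 k - e.1 k| ≤ 1 := by
  obtain ⟨z, q⟩ := p
  rcases mem_torusPlaqEdges_cases h with ⟨hk, hz | hz⟩ | ⟨hk, hz | hz⟩ <;>
    simp only [torusEdge] at hz hk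
  · refine ⟨(e.1, q), ?_, ?_, fun k => by simp⟩
    · simp [projPlaq, hz]
    · simp only [plaquetteEdges, Finset.mem_insert, Finset.mem_singleton]
      exact Or.inl (Prod.ext rfl hk.symm)
  · refine ⟨(e.1 - Pi.single q.1.2 1, q), ?_, ?_, fun k => ?_⟩
    · simp only [projPlaq, Prod.mk.injEq, and_true]
      have : Torus.proj M (e.1 - Pi.single q.1.2 1) + Pi.single q.1.2 1 = Torus.proj M e.1 := by
        rw [← Int.cast_one (R := ZMod M), ← torusProj_add_single, sub_add_cancel]
      rw [← hz, Site.shift] at this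
      exact add_right_cancel this
    · simp only [plaquetteEdges, Finset.mem_insert, Finset.mem_singleton, sub_add_cancel]
      exact Or.inr (Or.inr (Or.inl (Prod.ext rfl hk.symm)))
    · by_cases hk' : k = q.1.2
      · subst hk'; simp
      · simp [Pi.single_eq_of_ne hk']
  · refine ⟨(e.1, q), ?_, ?_, fun k => by simp⟩
    · simp [projPlaq, hz]
    · simp only [plaquetteEdges, Finset.mem_insert, Finset.mem_singleton]
      exact Or.inr (Or.inr (Or.inr (Prod.ext rfl hk.symm)))
  · refine ⟨(e.1 - Pi.single q.1.1 1, q), ?_, ?_, fun k => ?_⟩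
    · simp only [projPlaq, Prod.mk.injEq, and_true]
      have : Torus.proj M (e.1 - Pi.single q.1.1 1) + Pi.single q.1.1 1 = Torus.proj M e.1 := by
        rw [← Int.cast_one (R := ZMod M), ← torusProj_add_single, sub_add_cancel]
      rw [← hz, Site.shift] at this
      exact add_right_cancel this
    · simp only [plaquetteEdges, Finset.mem_insert, Finset.mem_singleton, sub_add_cancel]
      exact Or.inr (Or.inl (Prod.ext rfl hk.symm))
    · by_cases hk' : k = q.1.1
      · subst hk'; simp
      · simp [Pi.single_eq_of_ne hk']

/-- The base point of the edge under a dart of a walk is a vertex of the walk. [folklore] -/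
theorem dartStep_base_mem_support {x y : Literature.Probability.LatticeModels.Site d}
    (w : (zdGraph d).Walk x y) {f : (zdGraph d).Dart} (hf : f ∈ w.darts) : (dartStep f).1.1 ∈ w.support := by
  unfold dartStep
  split_ifs
  · exact w.dart_fst_mem_support_of_mem_darts hf
  · exact w.dart_snd_mem_support_of_mem_darts hf

/-- **Separation of loop edges on a large torus.** If the periodisations of two edges of a walk of
length `ℓ` lie on a common plaquette of a torus of side `M > ℓ + 2`, the two edges coincide or
share a plaquette of `ℤ^d` (so a non-corner edge of the loop is still "non-corner" on the torus).
[folklore] -/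
theorem eq_or_sharePlaquette_of_torus {x y : Literature.Probability.LatticeModels.Site d}
    (w : (zdGraph d).Walk x y) (hM : w.length + 2 < M) {f f' : (zdGraph d).Dart} (hf : f ∈ w.darts)
    (hf' : f' ∈ w.darts) {p : Plaquette d M} (h1 : torusEdge M (dartStep f).1 ∈ torusPlaqEdges p)
    (h2 : torusEdge M (dartStep f').1 ∈ torusPlaqEdges p) :
    (dartStep f).1 = (dartStep f').1 ∨ SharePlaquette (dartStep f).1 (dartStep f').1 := by
  obtain ⟨P, rfl, heP, hP⟩ := exists_projPlaq_eq_of_mem h1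
  rw [torusPlaqEdges_projPlaq, Finset.mem_image] at h2
  obtain ⟨g, hg, hgf'⟩ := h2
  -- `g` and the edge under `f'` have the same periodisation and are close, hence equal
  have hgeq : g = (dartStep f').1 := by
    obtain ⟨hb, hdir⟩ := Prod.mk.inj hgf'
    refine Prod.ext (eq_of_proj_eq_of_abs_sub_lt hb fun k => ?_) hdir
    have ha := abs_sub_le_one_of_mem_plaquetteEdges hg k
    have hb' := hP k
    have hc := abs_sub_le_length_of_mem_support w (dartStep_base_mem_support w hf)
      (dartStep_base_mem_support w hf') k
    have hM' : (w.length : ℤ) + 2 < M := by exact_mod_cast hM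
    calc |g.1 k - (dartStep f').1.1 k|
        ≤ |g.1 k - P.1 k| + |P.1 k - (dartStep f).1.1 k| + |(dartStep f).1.1 k - (dartStep f').1.1 k| := by
          have := abs_sub_le (g.1 k) (P.1 k) ((dartStep f').1.1 k)
          have := abs_sub_le (P.1 k) ((dartStep f).1.1 k) ((dartStep f').1.1 k)
          linarith
      _ < M := by linarith
  subst hgeq
  by_cases heq : (dartStep f).1 = (dartStep f').1
  · exact Or.inl heq
  · exact Or.inr ⟨P, heP, hg⟩

end Separation

/-! ### The upper bound -/

section Upper

variable {M : ℕ}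

/-- `torusLoopEdges` is the image of `walkEdges` under the periodisation. [folklore] -/
theorem torusLoopEdges_eq_image (M : ℕ) {x y : Literature.Probability.LatticeModels.Site d}
    (w : (zdGraph d).Walk x y) : torusLoopEdges M w = (walkEdges w).image (torusEdge M) := by
  ext a
  simp only [torusLoopEdges, torusLoopEdgeList, walkEdges, List.mem_toFinset, List.mem_map,
    Finset.mem_image]
  constructor
  · rintro ⟨e, he, rfl⟩
    exact ⟨_, ⟨e, he, rfl⟩, rfl⟩
  · rintro ⟨b, ⟨e, he, rfl⟩, rfl⟩
    exact ⟨e, he, rfl⟩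

/-- A trail has `ℓ` distinct edges. [folklore] -/
theorem card_walkEdges_of_isTrail {x y : Literature.Probability.LatticeModels.Site d}
    {w : (zdGraph d).Walk x y} (hw : w.IsTrail) : (walkEdges w).card = w.length := by
  rw [walkEdges, List.toFinset_card_of_nodup (nodup_map_dartStep_of_isTrail hw), List.length_map,
    SimpleGraph.Walk.length_darts]

/-- The periodised non-corner edges of the loop (`γ₁` of Chatterjee 2020, §7, read on the torus).
[cite: arXiv181109770, §7 (γ₁ = the non-corner edges)] -/
def torusNonCornerEdges (M : ℕ) {x y : Literature.Probability.LatticeModels.Site d}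
    (w : (zdGraph d).Walk x y) : Finset (Edge d M) :=
  (walkEdges w \ cornerEdges w).image (torusEdge M)

/-- The periodised non-corner edges are among the periodised edges. [folklore] -/
theorem torusNonCornerEdges_subset (M : ℕ) {x y : Literature.Probability.LatticeModels.Site d}
    (w : (zdGraph d).Walk x y) : torusNonCornerEdges M w ⊆ torusLoopEdges M w := by
  rw [torusLoopEdges_eq_image]
  exact Finset.image_subset_image Finset.sdiff_subset

/-- On a torus of side `M > ℓ` the loop has `ℓ - ℓ₀` periodised non-corner edges. [folklore] -/
theorem card_torusNonCornerEdges {x y : Literature.Probability.LatticeModels.Site d}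
    {w : (zdGraph d).Walk x y} (hw : w.IsTrail) (hM : w.length < M) :
    (torusNonCornerEdges M w).card = w.length - numCornerEdges w := by
  rw [torusNonCornerEdges, Finset.card_image_of_injOn, Finset.card_sdiff_of_subset
    (cornerEdges_subset_walkEdges w), card_walkEdges_of_isTrail hw, numCornerEdges]
  intro a ha b hb hab
  simp only [Finset.coe_sdiff, Set.mem_sdiff, Finset.mem_coe, walkEdges, List.mem_toFinset,
    List.mem_map] at ha hb
  obtain ⟨⟨f, hf, rfl⟩, -⟩ := ha
  obtain ⟨⟨f', hf', rfl⟩, -⟩ := hb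
  exact torusEdge_injOn_darts w hM hf hf' hab

/-- **Every interaction set meets the periodised non-corner edges at most once** (torus side
`M > ℓ + 2`): two of them on a common torus plaquette would be distinct edges of `γ` sharing a
plaquette of `ℤ^d`, i.e. corner edges (Chatterjee 2020, §7: "no two non-corner edges belong to the
same plaquette"). [cite: arXiv181109770, §7] -/
theorem card_torusPlaqEdges_inter_nonCorner_le_one {x y : Literature.Probability.LatticeModels.Site d}
    (w : (zdGraph d).Walk x y) (hM : w.length + 2 < M) (p : Plaquette d M) :
    (torusPlaqEdges p ∩ torusNonCornerEdges M w).card ≤ 1 := by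
  refine Finset.card_le_one.2 fun a ha b hb => ?_
  rw [Finset.mem_inter] at ha hb
  obtain ⟨hap, ha⟩ := ha
  obtain ⟨hbp, hb⟩ := hb
  simp only [torusNonCornerEdges, Finset.mem_image, Finset.mem_sdiff] at ha hb
  obtain ⟨ea, ⟨hea, heac⟩, rfl⟩ := ha
  obtain ⟨eb, ⟨heb, hebc⟩, rfl⟩ := hb
  have hea' := hea
  have heb' := heb
  simp only [walkEdges, List.mem_toFinset, List.mem_map] at hea' heb'
  obtain ⟨f, hf, rfl⟩ := hea'
  obtain ⟨f', hf', rfl⟩ := heb'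
  rcases eq_or_sharePlaquette_of_torus w hM hf hf' hap hbp with h | h
  · rw [h]
  · by_cases hne : (dartStep f').1 = (dartStep f).1
    · rw [hne]
    · exact absurd ((mem_cornerEdges_iff w _).2 ⟨hea, _, heb, hne, h⟩) heac

/-- **GKS upper bound for `ℤ₂` Wilson loops on the torus**: for `β ≥ 0`, a torus of side
`M > ℓ + 2` and a self-avoiding loop `γ` (trail) of length `ℓ` with `ℓ₀ = numCornerEdges γ`
corner edges, `⟨W_γ⟩_{Λ_M,β} ≤ (tanh 2(d-1)β)^{ℓ - ℓ₀}` (`= (tanh 6β)^{ℓ-ℓ₀}` for `d = 4`):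
Chatterjee 2020, Lemma 7.2 (`|μ'_β(W_γ)| = ∏_{e ∈ γ₁} |μ'_β(σ_e)| ≤ (1 - 2/(1+e^{12β}))^{ℓ-ℓ₀}`),
proved here in finite volume with periodic boundary conditions by GKS freezing
(`gksExpect_spinProduct_le_prod_tanh`) instead of conditioning. [cite: arXiv181109770, Lemma 7.2] -/
theorem wilsonExpectation_z2_le_tanh_pow [NeZero M] [Fact (1 < M)] {β : ℝ} (hβ : 0 ≤ β)
    {x : Literature.Probability.LatticeModels.Site d} {w : (zdGraph d).Walk x x} (hw : w.IsTrail)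
    (hM : w.length + 2 < M) :
    wilsonExpectation (L := M) z2Rep β (toTorusObservable M (wilsonLoopObs z2Character w)) ≤
      Real.tanh (2 * (d - 1 : ℕ) * β) ^ (w.length - numCornerEdges w) := by
  have hM' : w.length < M := by omega
  rw [wilsonExpectation_z2_eq_gksExpect β hw hM', ← card_torusNonCornerEdges hw hM',
    ← Finset.prod_const]
  refine (gksExpect_spinProduct_le_prod_tanh univ (fun _ => β) torusPlaqEdges (fun _ _ => hβ)
    (torusNonCornerEdges_subset M w) (fun p _ => card_torusPlaqEdges_inter_nonCorner_le_one w hM p)).trans ?_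
  refine Finset.prod_le_prod (fun a _ => tanh_nonneg (siteCoupling_torus_nonneg hβ a)) fun a _ => ?_
  exact tanh_le_tanh (siteCoupling_torus_le hβ a)

end Upper

/-! ### Passage to infinite-volume limit points of the torus states -/

section Limits

/-- The `ℤ₂` loop expectation of a limit point is the limit of the torus expectations along the
defining subsequence of tori (the Wilson loop variable is a bounded cylinder observable,
continuous since `ℤ₂` is discrete). [folklore] -/
theorem tendsto_wilsonExpectation_z2_loop {β : ℝ} {μ : Measure (LGConfig d (Multiplicative (ZMod 2)))}
    {Ls : ℕ → ℕ} (hμ : IsInfiniteVolumeLimitAlong z2Rep β Ls μ)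
    {x : Literature.Probability.LatticeModels.Site d} (w : (zdGraph d).Walk x x) :
    Tendsto (fun k : ℕ => wilsonExpectation (L := Ls k + 1) z2Rep β
        (toTorusObservable (Ls k + 1) (wilsonLoopObs z2Character w)))
      atTop (𝓝 (loopExpectation μ z2Character w)) :=
  hμ.2 (wilsonLoopObs z2Character w) _ (isCylinder_wilsonLoopObs _ _)
    (continuous_wilsonLoopObs continuous_of_discreteTopology _)
    (exists_abs_wilsonLoopObs_le continuous_of_discreteTopology _)

/-- **`⟨W_γ⟩_μ ≥ 0` for every infinite-volume limit point of `ℤ₂` lattice gauge theory**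
(`β ≥ 0`, `γ` a self-avoiding loop): GKS I on all large tori, passed to the limit (lower half of
Chatterjee 2020, Lemma 7.2, for torus states). [cite: arXiv181109770, Lemma 7.2] -/
theorem loopExpectation_z2_nonneg {β : ℝ} (hβ : 0 ≤ β) {μ : Measure (LGConfig d (Multiplicative (ZMod 2)))}
    (hμ : μ ∈ infiniteVolumeLimitPoints (d := d) z2Rep β)
    {x : Literature.Probability.LatticeModels.Site d} {w : (zdGraph d).Walk x x} (hw : w.IsTrail) :
    0 ≤ loopExpectation μ z2Character w := by
  obtain ⟨Ls, hLs, hlim⟩ := hμ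
  refine ge_of_tendsto (tendsto_wilsonExpectation_z2_loop hlim w) ?_
  filter_upwards [hLs.tendsto_atTop.eventually (eventually_gt_atTop (w.length + 2))] with k hk
  haveI : Fact (1 < Ls k + 1) := ⟨by omega⟩
  exact wilsonExpectation_z2_nonneg hβ hw (by omega)

/-- **`⟨W_γ⟩_μ ≤ (tanh 2(d-1)β)^{ℓ-ℓ₀}` for every infinite-volume limit point of `ℤ₂` lattice
gauge theory** (`β ≥ 0`, `γ` a self-avoiding loop of length `ℓ` with `ℓ₀ = numCornerEdges γ`
corner edges): the torus bound `wilsonExpectation_z2_le_tanh_pow` on all large tori, passed to the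
limit. For `d = 4` this is Chatterjee's `(tanh 6β)^{ℓ-ℓ₀} = (1 - 2/(1+e^{12β}))^{ℓ-ℓ₀}`
(CMP 377 (2020), Lemma 7.2), for the tree's torus-state convention. [cite: arXiv181109770, Lemma 7.2] -/
theorem loopExpectation_z2_le_tanh_pow {β : ℝ} (hβ : 0 ≤ β)
    {μ : Measure (LGConfig d (Multiplicative (ZMod 2)))} (hμ : μ ∈ infiniteVolumeLimitPoints (d := d) z2Rep β)
    {x : Literature.Probability.LatticeModels.Site d} {w : (zdGraph d).Walk x x} (hw : w.IsTrail) :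
    loopExpectation μ z2Character w ≤ Real.tanh (2 * (d - 1 : ℕ) * β) ^ (w.length - numCornerEdges w) := by
  obtain ⟨Ls, hLs, hlim⟩ := hμ
  refine le_of_tendsto (tendsto_wilsonExpectation_z2_loop hlim w) ?_
  filter_upwards [hLs.tendsto_atTop.eventually (eventually_gt_atTop (w.length + 2))] with k hk
  haveI : Fact (1 < Ls k + 1) := ⟨by omega⟩
  exact wilsonExpectation_z2_le_tanh_pow hβ hw (by omega)

/-- The four-dimensional case in Chatterjee's form: `0 ≤ ⟨W_γ⟩_μ ≤ (tanh 6β)^{ℓ - ℓ₀}` for every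
`μ ∈ infiniteVolumeLimitPoints z2Rep β`, `β ≥ 0`, and every self-avoiding loop `γ` in `ℤ⁴`
(CMP 377 (2020), Lemma 7.2, torus states; `tanh 6β = 1 - 2/(1 + e^{12β})`). [cite: arXiv181109770, Lemma 7.2] -/
theorem loopExpectation_z2_mem_Icc_d4 {β : ℝ} (hβ : 0 ≤ β)
    {μ : Measure (LGConfig 4 (Multiplicative (ZMod 2)))} (hμ : μ ∈ infiniteVolumeLimitPoints (d := 4) z2Rep β)
    {x : Literature.Probability.LatticeModels.Site 4} {w : (zdGraph 4).Walk x x} (hw : w.IsTrail) :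
    loopExpectation μ z2Character w ∈
      Set.Icc 0 (Real.tanh (6 * β) ^ (w.length - numCornerEdges w)) := by
  refine ⟨loopExpectation_z2_nonneg hβ hμ hw, ?_⟩
  have h := loopExpectation_z2_le_tanh_pow hβ hμ hw
  norm_num at h
  exact h

/-- Chatterjee's printed form of the upper bound (CMP 377 (2020), proof of Lemma 7.2:
`|μ_β(σ_e)| ≤ 1 - 2/(1 + e^{12β})`, hence `|⟨W_γ⟩| ≤ (1 - 2/(1 + e^{12β}))^{ℓ-ℓ₀}`), here for every
infinite-volume limit point of the four-dimensional torus states and `β ≥ 0`: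
`⟨W_γ⟩_μ ≤ (1 - 2/(1 + e^{12β}))^{ℓ - ℓ₀}` (`= (tanh 6β)^{ℓ-ℓ₀}`). [cite: arXiv181109770, Lemma 7.2 (proof)] -/
theorem loopExpectation_z2_le_chatterjee_d4 {β : ℝ} (hβ : 0 ≤ β)
    {μ : Measure (LGConfig 4 (Multiplicative (ZMod 2)))} (hμ : μ ∈ infiniteVolumeLimitPoints (d := 4) z2Rep β)
    {x : Literature.Probability.LatticeModels.Site 4} {w : (zdGraph 4).Walk x x} (hw : w.IsTrail) :
    loopExpectation μ z2Character w ≤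
      (1 - 2 / (1 + Real.exp (12 * β))) ^ (w.length - numCornerEdges w) := by
  have h := (loopExpectation_z2_mem_Icc_d4 hβ hμ hw).2
  rw [tanh_eq_one_sub_div, show (2 : ℝ) * (6 * β) = 12 * β by ring, add_comm] at h
  exact h

end Limits

/-! ### One-sided leading-order asymptotics: `⟨W_γ⟩_μ ≤ e^{-2ℓe^{-12β}} + 2ℓ₀e^{-12β} + 2ℓe^{-24β}` -/

section Asymptotics

/-- `aⁿ - bⁿ ≤ n (a - b)` for `0 ≤ b ≤ a ≤ 1` (Chatterjee 2020, end of the proof of Lemma 7.1: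
"the inequality `|a^ℓ - b^ℓ| ≤ ℓ|a - b|` for `a, b ∈ [0,1]`"). [cite: arXiv181109770, proof of Lemma 7.1] -/
theorem pow_sub_pow_le_mul_sub {a b : ℝ} (hb : 0 ≤ b) (hba : b ≤ a) (ha : a ≤ 1) (n : ℕ) :
    a ^ n - b ^ n ≤ n * (a - b) := by
  induction n with
  | zero => simp
  | succ n ih =>
    have ha0 : 0 ≤ a := hb.trans hba
    have hbn : b ^ n ≤ 1 := pow_le_one₀ hb (hba.trans ha)
    have hpow : b ^ n ≤ a ^ n := pow_le_pow_left₀ hb hba n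
    have key : a ^ (n + 1) - b ^ (n + 1) = a * (a ^ n - b ^ n) + (a - b) * b ^ n := by ring
    rw [key, Nat.cast_succ]
    have h1 : a * (a ^ n - b ^ n) ≤ 1 * (n * (a - b)) :=
      mul_le_mul ha ih (sub_nonneg.2 hpow) zero_le_one
    have h2 : (a - b) * b ^ n ≤ (a - b) * 1 := mul_le_mul_of_nonneg_left hbn (sub_nonneg.2 hba)
    linarith

/-- `1 - θᵏ ≤ k (1 - θ)` for `0 ≤ θ ≤ 1` (Bernoulli; Chatterjee 2020, (theta3) with `j = ℓ₀`).
[cite: arXiv181109770, proof of Lemma 7.1 (theta3)] -/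
theorem one_sub_pow_le_mul_one_sub {θ : ℝ} (h0 : 0 ≤ θ) (h1 : θ ≤ 1) (k : ℕ) :
    1 - θ ^ k ≤ k * (1 - θ) := by
  have := pow_sub_pow_le_mul_sub h0 h1 le_rfl k
  rwa [one_pow] at this

/-- `θ = tanh 6β` versus the Poisson factor: `tanh 6β ≤ e^{-2e^{-12β}} + 2e^{-24β}` (Chatterjee 2020,
end of the proof of Lemma 7.1: `θ = 1 - 2e^{-12β}/(1 + e^{-12β}) = e^{-2e^{-12β}} + O(e^{-24β})`;
here the one-sided bound with constant `2`, from `e^{-x} ≥ 1 - x`). [cite: arXiv181109770, proof of Lemma 7.1] -/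
theorem tanh_six_mul_le_exp_add (β : ℝ) :
    Real.tanh (6 * β) ≤ Real.exp (-2 * Real.exp (-12 * β)) + 2 * Real.exp (-24 * β) := by
  set u : ℝ := Real.exp (-12 * β) with hu
  have hu0 : 0 < u := Real.exp_pos _
  -- `tanh 6β = 1 - 2u/(1+u)` with `u = e^{-12β}`
  have hθ : Real.tanh (6 * β) = 1 - 2 * u / (1 + u) := by
    rw [tanh_eq_one_sub_div, show (2 : ℝ) * (6 * β) = 12 * β by ring]
    have h12 : Real.exp (12 * β) = u⁻¹ := by rw [hu, ← Real.exp_neg]; ring_nf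
    rw [h12]
    field_simp
  have hsq : u ^ 2 = Real.exp (-24 * β) := by
    rw [hu, sq, ← Real.exp_add]; ring_nf
  have hexp : 1 - 2 * u ≤ Real.exp (-2 * u) := by
    have := Real.add_one_le_exp (-2 * u)
    linarith
  have hfrac : 1 - 2 * u / (1 + u) ≤ (1 - 2 * u) + 2 * u ^ 2 := by
    have h1u : 0 < 1 + u := by linarith
    have : 2 * u / (1 + u) = 2 * u - 2 * u ^ 2 / (1 + u) := by
      field_simp
      ring
    rw [this]
    have : 2 * u ^ 2 / (1 + u) ≤ 2 * u ^ 2 := by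
      rw [div_le_iff₀ h1u]
      nlinarith
    linarith
  rw [hθ, ← hsq]
  linarith

/-- **One-sided leading-order asymptotics of `ℤ₂` Wilson loops (torus states).** For every
infinite-volume limit point `μ` of the four-dimensional torus `ℤ₂` states at `β ≥ 0` and every
self-avoiding loop `γ` of length `ℓ` with `ℓ₀ = numCornerEdges γ` corner edges,
`⟨W_γ⟩_μ - exp (-2ℓ e^{-12β}) ≤ 2 ℓ₀ e^{-12β} + 2 ℓ e^{-24β}`
(in Chatterjee's variables `α = ℓe^{-12β}`, `r = ℓ₀/ℓ`: `≤ 2rα + 2αe^{-12β}`, the shape of the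
error terms (w4w5) and of the last display of the proof of Lemma 7.1 in CMP 377 (2020)). This is
the upper half of the leading-order formula, obtained from `⟨W_γ⟩ ≤ θ^{ℓ-ℓ₀}` (GKS),
`θ^{ℓ-ℓ₀} - θ^ℓ ≤ ℓ₀ (1 - θ) ≤ 2ℓ₀ e^{-12β}` and `θ^ℓ - e^{-2ℓe^{-12β}} ≤ ℓ (θ - e^{-2e^{-12β}})⁺ ≤
2ℓ e^{-24β}`; the lower half (`≥ -C₁(…)^{C₂}`) is the vortex analysis of Lemma 7.1 and is not
proved here. [cite: arXiv181109770, Lemma 7.1–7.2 (upper half, torus states)] -/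
theorem loopExpectation_z2_sub_mainTerm_le {β : ℝ} (hβ : 0 ≤ β)
    {μ : Measure (LGConfig 4 (Multiplicative (ZMod 2)))} (hμ : μ ∈ infiniteVolumeLimitPoints (d := 4) z2Rep β)
    {x : Literature.Probability.LatticeModels.Site 4} {w : (zdGraph 4).Walk x x} (hw : w.IsTrail) :
    loopExpectation μ z2Character w - z2WilsonMainTerm β w.length ≤
      2 * numCornerEdges w * Real.exp (-12 * β) + 2 * w.length * Real.exp (-24 * β) := by
  set θ : ℝ := Real.tanh (6 * β) with hθdef
  set u : ℝ := Real.exp (-12 * β) with hu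
  set ℓ : ℕ := w.length with hℓ
  set ℓ₀ : ℕ := numCornerEdges w with hℓ₀
  have hℓ₀ℓ : ℓ₀ ≤ ℓ := numCornerEdges_le_length w
  have hθ0 : 0 ≤ θ := tanh_nonneg (by linarith)
  have hθ1 : θ ≤ 1 := (Real.tanh_lt_one _).le
  have hu0 : 0 < u := Real.exp_pos _
  -- (1) GKS: `⟨W⟩ ≤ θ^{ℓ-ℓ₀}`
  have h1 : loopExpectation μ z2Character w ≤ θ ^ (ℓ - ℓ₀) :=
    (loopExpectation_z2_mem_Icc_d4 hβ hμ hw).2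
  -- (2) `θ^{ℓ-ℓ₀} ≤ θ^ℓ + ℓ₀ (1 - θ)` and `1 - θ ≤ 2u`
  have h2 : θ ^ (ℓ - ℓ₀) ≤ θ ^ ℓ + ℓ₀ * (1 - θ) := by
    have hsplit : θ ^ ℓ = θ ^ (ℓ - ℓ₀) * θ ^ ℓ₀ := by rw [← pow_add, Nat.sub_add_cancel hℓ₀ℓ]
    have hb := one_sub_pow_le_mul_one_sub hθ0 hθ1 ℓ₀
    have hp : θ ^ (ℓ - ℓ₀) ≤ 1 := pow_le_one₀ hθ0 hθ1
    have hp0 : 0 ≤ θ ^ (ℓ - ℓ₀) := pow_nonneg hθ0 _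
    have : θ ^ (ℓ - ℓ₀) - θ ^ ℓ = θ ^ (ℓ - ℓ₀) * (1 - θ ^ ℓ₀) := by rw [hsplit]; ring
    nlinarith [pow_le_one₀ (n := ℓ₀) hθ0 hθ1]
  have h1θ : 1 - θ ≤ 2 * u := by
    rw [hθdef, tanh_eq_one_sub_div, show (2 : ℝ) * (6 * β) = 12 * β by ring]
    have h12 : Real.exp (12 * β) = u⁻¹ := by rw [hu, ← Real.exp_neg]; ring_nf
    rw [h12, sub_sub_cancel, div_le_iff₀ (by positivity)]
    nlinarith [mul_inv_cancel₀ hu0.ne']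
  -- (3) `θ^ℓ ≤ e^{-2uℓ} + 2ℓu²`
  have h3 : θ ^ ℓ ≤ Real.exp (-2 * u) ^ ℓ + ℓ * (2 * Real.exp (-24 * β)) := by
    by_cases hcmp : Real.exp (-2 * u) ≤ θ
    · have := pow_sub_pow_le_mul_sub (Real.exp_pos _).le hcmp hθ1 ℓ
      have hd : θ - Real.exp (-2 * u) ≤ 2 * Real.exp (-24 * β) := by
        have := tanh_six_mul_le_exp_add β; linarith
      have hℓnn : (0 : ℝ) ≤ ℓ := Nat.cast_nonneg _
      nlinarith
    · push Not at hcmp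
      have := pow_le_pow_left₀ hθ0 hcmp.le ℓ
      have : (0 : ℝ) ≤ ℓ * (2 * Real.exp (-24 * β)) := by positivity
      linarith
  have hmain : Real.exp (-2 * u) ^ ℓ = z2WilsonMainTerm β ℓ := by
    rw [z2WilsonMainTerm, ← Real.exp_nat_mul, hu]; ring_nf
  have hℓ₀nn : (0 : ℝ) ≤ ℓ₀ := Nat.cast_nonneg _
  calc loopExpectation μ z2Character w - z2WilsonMainTerm β ℓ
      ≤ θ ^ ℓ + ℓ₀ * (1 - θ) - z2WilsonMainTerm β ℓ := by linarith
    _ ≤ (z2WilsonMainTerm β ℓ + ℓ * (2 * Real.exp (-24 * β))) + ℓ₀ * (2 * u) - z2WilsonMainTerm β ℓ := by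
        have := mul_le_mul_of_nonneg_left h1θ hℓ₀nn
        rw [← hmain]; linarith
    _ = 2 * ℓ₀ * Real.exp (-12 * β) + 2 * ℓ * Real.exp (-24 * β) := by rw [hu]; ring

end Asymptotics

end Literature.MathematicalPhysics.QuantumFieldTheory
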